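import Summits.ValiantsHypothesis.ValiantsHypothesis.Theorems.LacunarySymmetroidMatrixDescartesCensusDoorA34AnnihilatorDichotomy
import Summits.ValiantsHypothesis.ValiantsHypothesis.Theorems.LacunarySymmetroidMatrixDescartesCensusOffHypersurface

/-!
# `MatrixDescartes` census — DOOR A at `(3,4)`: the CHART ATLAS IS COMPLETE — `DoorA34` ⟺ the rows of two sixteen-parameter chart families
# (signed-equal-diagonal and hollow-corner pencils) on every support

HONEST FRAMING.  Object-search cell `pub-symmetroid`, door-A seat `val-sym-door-p3` (g17); item stmt-ValiantsHypothesis-19980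
`DoorA34 = PosRootLawAt 3 4 18` is OPEN and asserted nowhere in this file; the main theorem is an EQUIVALENCE between the door and two
explicit families of fewnomial rows, neither of which is bounded here.  Nothing here bounds `ζ_sym(3,4)`; nothing bears on `MatrixDescartes`
(stmt-ValiantsHypothesis-18050) or on `VP ≠ VNP`.

CONTENT (all supports; no `def`, no `sorry`).
* §13 THE CRAMER ANNIHILATORS (any commutative ring): for four symmetric letters, `A` = the `4 × 4` coordinate matrix `(T₀₀, T₁₁, T₂₂, 2T₀₁)`,
  `M = det A`, `b = −adj A·(2T₀₂)`, `b′ = −adj A·(2T₁₂)`, `B₁ = [[b₀,b₃,M],[b₃,b₁,0],[M,0,b₂]]`, `B₂ = [[b′₀,b′₃,0],[b′₃,b′₁,M],[0,M,b′₂]]`: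
  **`cramer_annihilators`** `tr(B₁T_l) = tr(B₂T_l) = 0` (from `A·adj A = det A·1`, no expansion); `isSymm_corner₁/₂`.
* §14 transport under ring maps (`map_trace_adjugate_mul`, `map_discExpr`) and **`exists_generic_polynomial`**: the polynomial
  `Φ = det B₁(X)·Disc(X)` in the `36` entry variables (Cramer annihilators of the symbolic letters; `Disc` = discriminant of
  `x ↦ det(B₂ − xB₁)`) satisfies `Φ(S₀) ≠ 0` at `S₀ = (E₀₀ − 2(E₁₂+E₂₁), E₁₁ − 2(E₀₂+E₂₀), E₂₂, ½(E₀₁+E₁₀))` (`A = 1`,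
  `B₁ = [[0,0,1],[0,4,0],[1,0,0]]`, `B₂ = [[4,0,0],[0,0,1],[0,1,0]]`, `det(B₂ − xB₁) = 4x³ − 4`), and `Φ(S) ≠ 0` at a symmetric tuple hands
  over symmetric annihilators `B₁, B₂` with `det B₁ ≠ 0` and non-zero discriminant — the hypotheses of `card_posRoots_le_of_chartRows`.
* §15 **`doorA34_iff_chartRows`**: `DoorA34 ↔ (E) ∧ (H)` with (E) the signed-equal-diagonal rows `≤ 18` (`εᵢ = ±1`) and (H) the
  hollow-corner rows `≤ 18` (`εᵢ ∈ {1,0,−1}`) on every `d`; **`not_doorA34_iff_chartNineteen`**: a nineteen exists iff one exists in a chart.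
THE CHAIN (this seat, eight earlier files): `…EqualDiagonalChart{,Rows}` (really-split nets ≅ signed-equal-diagonal), `…HollowCornerChart`
(frame / line-pair ⇒ hollow corner), `…HollowCornerR2` (unique simple real root ⇒ frame), `…AnnihilatorDichotomy` (Disc ≠ 0 ⇒ one of the
two), `…DenseRows` (sharp counts persist under perturbation of the letters), `…OffHypersurface` (rows off a hypersurface decide the door).
[folklore] Cramer's rule, pencils of conics, Cayley's four-nodal cubic symmetroid; elementary.
-/

-- `Summit.ValiantsHypothesis.ValiantsHypothesis.…` repeats a component by the D-0017 layout
-- (single-conjunct summit), which the `dupNamespace` linter flags; the name is mandated.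
set_option linter.dupNamespace false

namespace Summit.ValiantsHypothesis.ValiantsHypothesis.Theorems.LacunarySymmetroidMatrixDescartes.Census.EqualDiagonal

open Matrix Finset
open scoped BigOperators

/-! ## 13. The Cramer annihilators of a four-letter net (any commutative ring) -/

section Cramer
variable {R : Type*} [CommRing R]

/-- Cramer: `A · (−adj A · c) + det A · c = 0`. [folklore] -/
theorem mulVec_neg_adjugate_mulVec_add (A : Matrix (Fin 4) (Fin 4) R) (c : Fin 4 → R) (l : Fin 4) :
    (A *ᵥ (-(A.adjugate *ᵥ c))) l + A.det * c l = 0 := by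
  rw [Matrix.mulVec_neg, Matrix.mulVec_mulVec, Matrix.mul_adjugate, Matrix.smul_mulVec, Matrix.one_mulVec]
  simp

/-- Trace of a «first corner» matrix against a symmetric letter. [folklore] -/
theorem trace_corner₁_mul (T : Matrix (Fin 3) (Fin 3) R) (hT : T.IsSymm) (b : Fin 4 → R) (M : R) :
    ((!![b 0, b 3, M; b 3, b 1, 0; M, 0, b 2] : Matrix (Fin 3) (Fin 3) R) * T).trace
      = b 0 * T 0 0 + b 1 * T 1 1 + b 2 * T 2 2 + b 3 * (2 * T 0 1) + M * (2 * T 0 2) := by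
  have h10 : T 1 0 = T 0 1 := hT.apply 0 1
  have h20 : T 2 0 = T 0 2 := hT.apply 0 2
  rw [Matrix.trace_fin_three]
  simp [Matrix.mul_apply, Fin.sum_univ_three]
  rw [h10, h20]; ring

/-- Trace of a «second corner» matrix against a symmetric letter. [folklore] -/
theorem trace_corner₂_mul (T : Matrix (Fin 3) (Fin 3) R) (hT : T.IsSymm) (b : Fin 4 → R) (M : R) :
    ((!![b 0, b 3, 0; b 3, b 1, M; 0, M, b 2] : Matrix (Fin 3) (Fin 3) R) * T).trace
      = b 0 * T 0 0 + b 1 * T 1 1 + b 2 * T 2 2 + b 3 * (2 * T 0 1) + M * (2 * T 1 2) := by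
  have h10 : T 1 0 = T 0 1 := hT.apply 0 1
  have h21 : T 2 1 = T 1 2 := hT.apply 1 2
  rw [Matrix.trace_fin_three]
  simp [Matrix.mul_apply, Fin.sum_univ_three]
  rw [h10, h21]; ring

/-- The coordinate matrix of the net acting on a coefficient vector. [folklore] -/
theorem coordMatrix_mulVec (T : Fin 4 → Matrix (Fin 3) (Fin 3) R) (b : Fin 4 → R) (l : Fin 4) :
    ((Matrix.of fun l k => (![T l 0 0, T l 1 1, T l 2 2, 2 * T l 0 1] : Fin 4 → R) k) *ᵥ b) l
      = b 0 * T l 0 0 + b 1 * T l 1 1 + b 2 * T l 2 2 + b 3 * (2 * T l 0 1) := by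
  simp [Matrix.mulVec, dotProduct, Fin.sum_univ_four]
  ring

/-- **THE CRAMER ANNIHILATORS.**  For four symmetric letters `T_l` over any commutative ring let `A` be the `4 × 4` matrix of their
coordinates `(T₀₀, T₁₁, T₂₂, 2T₀₁)`, `M = det A`, `b = −adj A·(2T_l,₀₂)_l`, `b′ = −adj A·(2T_l,₁₂)_l`.  Then the symmetric matrices
`B₁ = [[b₀, b₃, M], [b₃, b₁, 0], [M, 0, b₂]]` and `B₂ = [[b′₀, b′₃, 0], [b′₃, b′₁, M], [0, M, b′₂]]` annihilate every letter:
`tr(B₁T_l) = tr(B₂T_l) = 0` (Cramer's rule; when `M ≠ 0` they span the annihilator pencil of the net). [folklore] -/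
theorem cramer_annihilators (T : Fin 4 → Matrix (Fin 3) (Fin 3) R) (hT : ∀ l, (T l).IsSymm)
    (A : Matrix (Fin 4) (Fin 4) R) (hA : A = Matrix.of fun l k => (![T l 0 0, T l 1 1, T l 2 2, 2 * T l 0 1] : Fin 4 → R) k)
    (b b' : Fin 4 → R) (hb : b = -(A.adjugate *ᵥ fun l => 2 * T l 0 2)) (hb' : b' = -(A.adjugate *ᵥ fun l => 2 * T l 1 2))
    (l : Fin 4) :
    ((!![b 0, b 3, A.det; b 3, b 1, 0; A.det, 0, b 2] : Matrix (Fin 3) (Fin 3) R) * T l).trace = 0 ∧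
    ((!![b' 0, b' 3, 0; b' 3, b' 1, A.det; 0, A.det, b' 2] : Matrix (Fin 3) (Fin 3) R) * T l).trace = 0 := by
  constructor
  · rw [trace_corner₁_mul _ (hT l), ← coordMatrix_mulVec T b l, ← hA, hb]
    exact mulVec_neg_adjugate_mulVec_add A _ l
  · rw [trace_corner₂_mul _ (hT l), ← coordMatrix_mulVec T b' l, ← hA, hb']
    exact mulVec_neg_adjugate_mulVec_add A _ l

/-- The Cramer annihilators are symmetric. [folklore] -/
theorem isSymm_corner₁ (b : Fin 4 → R) (M : R) : ((!![b 0, b 3, M; b 3, b 1, 0; M, 0, b 2] : Matrix (Fin 3) (Fin 3) R)).IsSymm := by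
  refine Matrix.IsSymm.ext fun i j => ?_
  fin_cases i <;> fin_cases j <;> simp

/-- The Cramer annihilators are symmetric. [folklore] -/
theorem isSymm_corner₂ (b : Fin 4 → R) (M : R) : ((!![b 0, b 3, 0; b 3, b 1, M; 0, M, b 2] : Matrix (Fin 3) (Fin 3) R)).IsSymm := by
  refine Matrix.IsSymm.ext fun i j => ?_
  fin_cases i <;> fin_cases j <;> simp

end Cramer

/-! ## 14. Transport of the Cramer data under ring maps; the generic polynomial; the full reduction -/

section Transport
variable {R R' : Type*} [CommRing R] [CommRing R']

/-- A ring map commutes with `tr(adj M · N)`. [folklore] -/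
theorem map_trace_adjugate_mul (f : R →+* R') (M N : Matrix (Fin 3) (Fin 3) R) :
    f ((M.adjugate * N).trace) = ((f.mapMatrix M).adjugate * f.mapMatrix N).trace := by
  rw [← RingHom.map_adjugate]
  simp only [Matrix.trace, Matrix.diag, map_sum, RingHom.mapMatrix_apply]
  refine Finset.sum_congr rfl fun i _ => ?_
  rw [RingHom.map_matrix_mul]

/-- A ring map commutes with the discriminant expression of the annihilator cubic. [folklore] -/
theorem map_discExpr (f : R →+* R') (B₁ B₂ : Matrix (Fin 3) (Fin 3) R) :
    f ((B₁.adjugate * B₂).trace ^ 2 * (-(B₂.adjugate * B₁).trace) ^ 2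
        - 4 * (-B₁.det) * (-(B₂.adjugate * B₁).trace) ^ 3 - 4 * (B₁.adjugate * B₂).trace ^ 3 * B₂.det
        - 27 * (-B₁.det) ^ 2 * B₂.det ^ 2
        + 18 * (-B₁.det) * (B₁.adjugate * B₂).trace * (-(B₂.adjugate * B₁).trace) * B₂.det)
      = ((f.mapMatrix B₁).adjugate * f.mapMatrix B₂).trace ^ 2 * (-((f.mapMatrix B₂).adjugate * f.mapMatrix B₁).trace) ^ 2
        - 4 * (-(f.mapMatrix B₁).det) * (-((f.mapMatrix B₂).adjugate * f.mapMatrix B₁).trace) ^ 3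
        - 4 * ((f.mapMatrix B₁).adjugate * f.mapMatrix B₂).trace ^ 3 * (f.mapMatrix B₂).det
        - 27 * (-(f.mapMatrix B₁).det) ^ 2 * (f.mapMatrix B₂).det ^ 2
        + 18 * (-(f.mapMatrix B₁).det) * ((f.mapMatrix B₁).adjugate * f.mapMatrix B₂).trace
          * (-((f.mapMatrix B₂).adjugate * f.mapMatrix B₁).trace) * (f.mapMatrix B₂).det := by
  simp only [map_add, map_sub, map_mul, map_pow, map_neg, map_ofNat, RingHom.map_det, map_trace_adjugate_mul]

end Transport

section Atlas

/-- **THE GENERIC POLYNOMIAL.**  There is a real polynomial `Φ` in the `36` entry variables of a four-letter `3 × 3` tuple, non-zero at an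
explicit symmetric tuple, such that every symmetric tuple `S` with `Φ(S) ≠ 0` is annihilated by two symmetric matrices `B₁, B₂` (the CRAMER
ANNIHILATORS of §13) with `det B₁ ≠ 0` and non-zero discriminant of `x ↦ det(B₂ − xB₁)` — the hypotheses of `card_posRoots_le_of_chartRows`.
(`Φ = det B₁(X) · Disc(X)` on the Cramer annihilators of the symbolic letters.) [folklore] -/
theorem exists_generic_polynomial :
    ∃ Φ : MvPolynomial (Fin 4 × Fin 3 × Fin 3) ℝ,
      (∃ S₀ : Fin 4 → Matrix (Fin 3) (Fin 3) ℝ, (∀ l, (S₀ l).IsSymm) ∧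
        MvPolynomial.eval (fun idx : Fin 4 × Fin 3 × Fin 3 => S₀ idx.1 idx.2.1 idx.2.2) Φ ≠ 0) ∧
      ∀ S : Fin 4 → Matrix (Fin 3) (Fin 3) ℝ, (∀ l, (S l).IsSymm) →
        MvPolynomial.eval (fun idx : Fin 4 × Fin 3 × Fin 3 => S idx.1 idx.2.1 idx.2.2) Φ ≠ 0 →
        ∃ B₁ B₂ : Matrix (Fin 3) (Fin 3) ℝ, B₁.IsSymm ∧ B₂.IsSymm ∧ (∀ l, (B₁ * S l).trace = 0) ∧ (∀ l, (B₂ * S l).trace = 0) ∧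
          B₁.det ≠ 0 ∧
          ((B₁.adjugate * B₂).trace ^ 2 * (-(B₂.adjugate * B₁).trace) ^ 2
            - 4 * (-B₁.det) * (-(B₂.adjugate * B₁).trace) ^ 3 - 4 * (B₁.adjugate * B₂).trace ^ 3 * B₂.det
            - 27 * (-B₁.det) ^ 2 * B₂.det ^ 2
            + 18 * (-B₁.det) * (B₁.adjugate * B₂).trace * (-(B₂.adjugate * B₁).trace) * B₂.det ≠ 0) := by
  classical
  -- the Cramer construction over an arbitrary commutative ring, on the UPPER entries of a letter tuple
  let TT : ∀ {R : Type} [CommRing R], (Fin 4 → Matrix (Fin 3) (Fin 3) R) → Fin 4 → Matrix (Fin 3) (Fin 3) R :=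
    fun T l => !![T l 0 0, T l 0 1, T l 0 2; T l 0 1, T l 1 1, T l 1 2; T l 0 2, T l 1 2, T l 2 2]
  let AA : ∀ {R : Type} [CommRing R], (Fin 4 → Matrix (Fin 3) (Fin 3) R) → Matrix (Fin 4) (Fin 4) R :=
    fun T => Matrix.of fun l k => (![T l 0 0, T l 1 1, T l 2 2, 2 * T l 0 1] : Fin 4 → _) k
  let bb : ∀ {R : Type} [CommRing R], (Fin 4 → Matrix (Fin 3) (Fin 3) R) → Fin 4 → R :=
    fun T => -((AA T).adjugate *ᵥ fun l => 2 * T l 0 2)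
  let bb' : ∀ {R : Type} [CommRing R], (Fin 4 → Matrix (Fin 3) (Fin 3) R) → Fin 4 → R :=
    fun T => -((AA T).adjugate *ᵥ fun l => 2 * T l 1 2)
  let BB₁ : ∀ {R : Type} [CommRing R], (Fin 4 → Matrix (Fin 3) (Fin 3) R) → Matrix (Fin 3) (Fin 3) R :=
    fun T => !![bb T 0, bb T 3, (AA T).det; bb T 3, bb T 1, 0; (AA T).det, 0, bb T 2]
  let BB₂ : ∀ {R : Type} [CommRing R], (Fin 4 → Matrix (Fin 3) (Fin 3) R) → Matrix (Fin 3) (Fin 3) R :=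
    fun T => !![bb' T 0, bb' T 3, 0; bb' T 3, bb' T 1, (AA T).det; 0, (AA T).det, bb' T 2]
  let disc : ∀ {R : Type} [CommRing R], Matrix (Fin 3) (Fin 3) R → Matrix (Fin 3) (Fin 3) R → R :=
    fun B₁ B₂ => (B₁.adjugate * B₂).trace ^ 2 * (-(B₂.adjugate * B₁).trace) ^ 2
        - 4 * (-B₁.det) * (-(B₂.adjugate * B₁).trace) ^ 3 - 4 * (B₁.adjugate * B₂).trace ^ 3 * B₂.det
        - 27 * (-B₁.det) ^ 2 * B₂.det ^ 2
        + 18 * (-B₁.det) * (B₁.adjugate * B₂).trace * (-(B₂.adjugate * B₁).trace) * B₂.det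
  -- symbolic letters
  let TX : Fin 4 → Matrix (Fin 3) (Fin 3) (MvPolynomial (Fin 4 × Fin 3 × Fin 3) ℝ) :=
    fun l => Matrix.of fun i j => MvPolynomial.X (l, i, j)
  -- symmetry of the upper-symmetrised letters
  have hTTsymm : ∀ {R : Type} [CommRing R] (T : Fin 4 → Matrix (Fin 3) (Fin 3) R) (l : Fin 4), (TT T l).IsSymm := by
    intro R _ T l
    refine Matrix.IsSymm.ext fun i j => ?_
    fin_cases i <;> fin_cases j <;> simp [TT]
  have hTTeq : ∀ (S : Fin 4 → Matrix (Fin 3) (Fin 3) ℝ), (∀ l, (S l).IsSymm) → ∀ l, TT S l = S l := by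
    intro S hS l
    ext i j
    have h10 : S l 1 0 = S l 0 1 := (hS l).apply 0 1
    have h20 : S l 2 0 = S l 0 2 := (hS l).apply 0 2
    have h21 : S l 2 1 = S l 1 2 := (hS l).apply 1 2
    fin_cases i <;> fin_cases j <;> simp [TT, h10, h20, h21]
  -- TRANSPORT: evaluation at the entries of `S` maps the symbolic Cramer data to the Cramer data of `S`
  have key : ∀ S : Fin 4 → Matrix (Fin 3) (Fin 3) ℝ,
      MvPolynomial.eval (fun idx : Fin 4 × Fin 3 × Fin 3 => S idx.1 idx.2.1 idx.2.2)
          ((BB₁ (TT TX)).det * disc (BB₁ (TT TX)) (BB₂ (TT TX)))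
        = (BB₁ (TT S)).det * disc (BB₁ (TT S)) (BB₂ (TT S)) := by
    intro S
    set φ := MvPolynomial.eval (fun idx : Fin 4 × Fin 3 × Fin 3 => S idx.1 idx.2.1 idx.2.2) with hφ
    have hX : ∀ l i j, φ (TT TX l i j) = TT S l i j := by
      intro l i j
      fin_cases i <;> fin_cases j <;> simp [hφ, TT, TX, MvPolynomial.eval_X]
    have hA : φ.mapMatrix (AA (TT TX)) = AA (TT S) := by
      ext l k
      fin_cases k <;> simp [AA, RingHom.mapMatrix_apply, Matrix.map_apply, hX, map_mul, map_ofNat]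
    have hadj : (AA (TT TX)).adjugate.map φ = (AA (TT S)).adjugate := by
      rw [← RingHom.mapMatrix_apply, RingHom.map_adjugate, hA]
    have hdetA : φ (AA (TT TX)).det = (AA (TT S)).det := by rw [RingHom.map_det, hA]
    have hb : ∀ k, φ (bb (TT TX) k) = bb (TT S) k := by
      intro k
      simp only [bb, Pi.neg_apply, map_neg]
      rw [RingHom.map_mulVec, hadj]
      congr 2
      funext l
      simp [Function.comp, hX, map_mul, map_ofNat]
    have hb' : ∀ k, φ (bb' (TT TX) k) = bb' (TT S) k := by
      intro k
      simp only [bb', Pi.neg_apply, map_neg]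
      rw [RingHom.map_mulVec, hadj]
      congr 2
      funext l
      simp [Function.comp, hX, map_mul, map_ofNat]
    have hB₁ : φ.mapMatrix (BB₁ (TT TX)) = BB₁ (TT S) := by
      ext i j
      fin_cases i <;> fin_cases j <;> simp [BB₁, RingHom.mapMatrix_apply, Matrix.map_apply, hb, hdetA]
    have hB₂ : φ.mapMatrix (BB₂ (TT TX)) = BB₂ (TT S) := by
      ext i j
      fin_cases i <;> fin_cases j <;> simp [BB₂, RingHom.mapMatrix_apply, Matrix.map_apply, hb', hdetA]
    rw [map_mul, RingHom.map_det, hB₁]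
    congr 1
    have h := map_discExpr φ (BB₁ (TT TX)) (BB₂ (TT TX))
    rw [hB₁, hB₂] at h
    exact h
  refine ⟨(BB₁ (TT TX)).det * disc (BB₁ (TT TX)) (BB₂ (TT TX)), ?_, ?_⟩
  · -- the witness: `S₀ = (E₀₀ − 2(E₁₂+E₂₁), E₁₁ − 2(E₀₂+E₂₀), E₂₂, ½(E₀₁+E₁₀))`
    set S₀ : Fin 4 → Matrix (Fin 3) (Fin 3) ℝ :=
      ![!![1, 0, 0; 0, 0, -2; 0, -2, 0], !![0, 0, -2; 0, 1, 0; -2, 0, 0], !![0, 0, 0; 0, 0, 0; 0, 0, 1],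
        !![0, 1/2, 0; 1/2, 0, 0; 0, 0, 0]] with hS₀
    have hS₀symm : ∀ l, (S₀ l).IsSymm := by
      intro l
      refine Matrix.IsSymm.ext fun i j => ?_
      fin_cases l <;> fin_cases i <;> fin_cases j <;> simp [hS₀]
    refine ⟨S₀, hS₀symm, ?_⟩
    rw [key S₀]
    have hA0 : AA (TT S₀) = 1 := by
      ext l k
      fin_cases l <;> fin_cases k <;> norm_num [AA, TT, hS₀, Matrix.one_apply, Matrix.cons_val', Matrix.cons_val_zero, Matrix.cons_val_one, Matrix.cons_val_two, Matrix.empty_val', Matrix.cons_val_fin_one, Matrix.head_cons, Matrix.tail_cons, Matrix.head_fin_const, Matrix.of_apply]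
    have hb0 : bb (TT S₀) = ![0, 4, 0, 0] := by
      simp only [bb, hA0, Matrix.adjugate_one, Matrix.one_mulVec]
      funext l
      fin_cases l <;> norm_num [TT, hS₀, Matrix.cons_val', Matrix.cons_val_zero, Matrix.cons_val_one, Matrix.cons_val_two, Matrix.empty_val', Matrix.cons_val_fin_one, Matrix.head_cons, Matrix.tail_cons, Matrix.head_fin_const, Matrix.of_apply]
    have hb0' : bb' (TT S₀) = ![4, 0, 0, 0] := by
      simp only [bb', hA0, Matrix.adjugate_one, Matrix.one_mulVec]
      funext l
      fin_cases l <;> norm_num [TT, hS₀, Matrix.cons_val', Matrix.cons_val_zero, Matrix.cons_val_one, Matrix.cons_val_two, Matrix.empty_val', Matrix.cons_val_fin_one, Matrix.head_cons, Matrix.tail_cons, Matrix.head_fin_const, Matrix.of_apply]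
    have hdet0 : (AA (TT S₀)).det = 1 := by rw [hA0, Matrix.det_one]
    have hB10 : BB₁ (TT S₀) = !![0, 0, 1; 0, 4, 0; 1, 0, 0] := by
      simp only [BB₁, hb0, hdet0]
      ext i j; fin_cases i <;> fin_cases j <;> simp
    have hB20 : BB₂ (TT S₀) = !![4, 0, 0; 0, 0, 1; 0, 1, 0] := by
      simp only [BB₂, hb0', hdet0]
      ext i j; fin_cases i <;> fin_cases j <;> simp
    rw [hB10, hB20]
    simp only [disc]
    norm_num [Matrix.det_fin_three, Matrix.adjugate_fin_three, Matrix.trace_fin_three, Matrix.mul_apply, Fin.sum_univ_three,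
      Matrix.cons_val', Matrix.cons_val_zero, Matrix.cons_val_one, Matrix.cons_val_two, Matrix.empty_val', Matrix.cons_val_fin_one, Matrix.head_cons, Matrix.tail_cons, Matrix.head_fin_const, Matrix.of_apply]
  · intro S hS hΦ
    rw [key S] at hΦ
    have hdet : (BB₁ (TT S)).det ≠ 0 := left_ne_zero_of_mul hΦ
    have hdisc : disc (BB₁ (TT S)) (BB₂ (TT S)) ≠ 0 := right_ne_zero_of_mul hΦ
    have hann := fun l => cramer_annihilators (TT S) (hTTsymm S) (AA (TT S)) rfl (bb (TT S)) (bb' (TT S)) rfl rfl l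
    refine ⟨BB₁ (TT S), BB₂ (TT S), isSymm_corner₁ _ _, isSymm_corner₂ _ _, fun l => ?_, fun l => ?_, hdet, hdisc⟩
    · have h := (hann l).1
      rw [hTTeq S hS l] at h
      exact h
    · have h := (hann l).2
      rw [hTTeq S hS l] at h
      exact h

/-! ## 15. `DoorA34` ⟺ the rows of the two sixteen-parameter chart families -/

/-- **`DoorA34` IS THE CONJUNCTION OF TWO SIXTEEN-PARAMETER FEWNOMIAL ROW FAMILIES.**  The cell's typed target `DoorA34 = PosRootLawAt 3 4 18`
(`Iff.rfl`-equal to the route item `Theses.LacunarySymmetroid.DoorA34`, stmt-ValiantsHypothesis-19980: every real symmetric `3 × 3` four-letter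
lacunary pencil has `≤ 18` distinct positive det-roots) holds IF AND ONLY IF, on every exponent vector `d : Fin 4 → ℕ`,
(E) every SIGNED-EQUAL-DIAGONAL pencil `∑_l X^{d_l} [[ε₀δ_l, α_l, β_l], [α_l, ε₁δ_l, γ_l], [β_l, γ_l, ε₂δ_l]]` (`εᵢ = ±1`;
  `det = ε₀ε₁ε₂δ³ − δ(ε₀γ² + ε₁β² + ε₂α²) + 2αβγ`; `ε` constant: the `4`-nomial `−δ(t)` against the spectrum of the hollow matrix
  `[[0,α,β],[α,0,γ],[β,γ,0]](t)`) has `≤ 18` distinct positive det-roots, AND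
(H) every HOLLOW-CORNER pencil `∑_l X^{d_l} [[ε₁u_l + ε₂w_l, α_l, β_l], [α_l, u_l, 0], [β_l, 0, w_l]]` (`εᵢ ∈ {1,0,−1}`;
  `det = uw(ε₁u + ε₂w) − α²w − β²u`) has `≤ 18` distinct positive det-roots.
Proof: `⇒` — chart pencils are symmetric pencils; `⇐` — `exists_generic_polynomial` + `DenseRows.doorA34_iff_rows_off_hypersurface`
(sharp rows are decided off any hypersurface) + `card_posRoots_le_of_chartRows` (annihilator dichotomy + the two chart theorems).
Nothing here bounds either family: `DoorA34` stays OPEN; this is the gauge-free, node-class-free form of the door. [folklore] -/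
theorem doorA34_iff_chartRows :
    DoorA34 ↔
      (∀ (d : Fin 4 → ℕ) (ε : Fin 3 → ℝ) (δ α β γ : Fin 4 → ℝ), (∀ i, ε i = 1 ∨ ε i = -1) →
        ((Matrix.det (∑ l, ((Polynomial.X : Polynomial ℝ) ^ d l) •
            (!![ε 0 * δ l, α l, β l; α l, ε 1 * δ l, γ l; β l, γ l, ε 2 * δ l] : Matrix (Fin 3) (Fin 3) ℝ).map
              Polynomial.C)).roots.toFinset.filter (fun t => 0 < t)).card ≤ 18) ∧
      (∀ (d : Fin 4 → ℕ) (ε₁ ε₂ : ℝ) (u w α β : Fin 4 → ℝ), (ε₁ = 1 ∨ ε₁ = 0 ∨ ε₁ = -1) → (ε₂ = 1 ∨ ε₂ = 0 ∨ ε₂ = -1) →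
        ((Matrix.det (∑ l, ((Polynomial.X : Polynomial ℝ) ^ d l) •
            (!![ε₁ * u l + ε₂ * w l, α l, β l; α l, u l, 0; β l, 0, w l] : Matrix (Fin 3) (Fin 3) ℝ).map
              Polynomial.C)).roots.toFinset.filter (fun t => 0 < t)).card ≤ 18) := by
  constructor
  · intro h
    exact ⟨fun d ε δ α β γ _ => signedEqualDiag_rows_of_doorA34 h d ε δ α β γ,
      fun d ε₁ ε₂ u w α β _ _ => hollowCorner_rows_of_doorA34 h d ε₁ ε₂ u w α β⟩
  · rintro ⟨hED, hHC⟩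
    obtain ⟨Φ, hΦ₀, hΦ⟩ := exists_generic_polynomial
    refine (DenseRows.doorA34_iff_rows_off_hypersurface Φ hΦ₀).mpr fun d S hS hne => ?_
    obtain ⟨B₁, B₂, hB₁, hB₂, hann₁, hann₂, hdet, hdisc⟩ := hΦ S hS hne
    exact card_posRoots_le_of_chartRows d (hED d) (hHC d) S hS B₁ B₂ hB₁ hB₂ hdet hann₁ hann₂ hdisc

/-- **Refutation currency of the charts**: a nineteen in EITHER chart family, on ANY support, refutes `DoorA34`; conversely `DoorA34` fails only if
one of the two families carries a nineteen. [folklore] -/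
theorem not_doorA34_iff_chartNineteen :
    ¬ DoorA34 ↔
      (∃ (d : Fin 4 → ℕ) (ε : Fin 3 → ℝ) (δ α β γ : Fin 4 → ℝ), (∀ i, ε i = 1 ∨ ε i = -1) ∧
        19 ≤ ((Matrix.det (∑ l, ((Polynomial.X : Polynomial ℝ) ^ d l) •
            (!![ε 0 * δ l, α l, β l; α l, ε 1 * δ l, γ l; β l, γ l, ε 2 * δ l] : Matrix (Fin 3) (Fin 3) ℝ).map
              Polynomial.C)).roots.toFinset.filter (fun t => 0 < t)).card) ∨
      (∃ (d : Fin 4 → ℕ) (ε₁ ε₂ : ℝ) (u w α β : Fin 4 → ℝ), (ε₁ = 1 ∨ ε₁ = 0 ∨ ε₁ = -1) ∧ (ε₂ = 1 ∨ ε₂ = 0 ∨ ε₂ = -1) ∧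
        19 ≤ ((Matrix.det (∑ l, ((Polynomial.X : Polynomial ℝ) ^ d l) •
            (!![ε₁ * u l + ε₂ * w l, α l, β l; α l, u l, 0; β l, 0, w l] : Matrix (Fin 3) (Fin 3) ℝ).map
              Polynomial.C)).roots.toFinset.filter (fun t => 0 < t)).card) := by
  rw [doorA34_iff_chartRows, not_and_or]
  push Not
  constructor
  · rintro (⟨d, ε, δ, α, β, γ, hε, hlt⟩ | ⟨d, ε₁, ε₂, u, w, α, β, h₁, h₂, hlt⟩)
    · exact Or.inl ⟨d, ε, δ, α, β, γ, hε, by omega⟩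
    · exact Or.inr ⟨d, ε₁, ε₂, u, w, α, β, h₁, h₂, by omega⟩
  · rintro (⟨d, ε, δ, α, β, γ, hε, hle⟩ | ⟨d, ε₁, ε₂, u, w, α, β, h₁, h₂, hle⟩)
    · exact Or.inl ⟨d, ε, δ, α, β, γ, hε, by omega⟩
    · exact Or.inr ⟨d, ε₁, ε₂, u, w, α, β, h₁, h₂, by omega⟩

end Atlas

end Summit.ValiantsHypothesis.ValiantsHypothesis.Theorems.LacunarySymmetroidMatrixDescartes.Census.EqualDiagonal
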